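import Mathlib
import Summits.MatrixMultiplication.MatrixMultiplication.Theses.ThinBlockAlpha
import Literature.Computability.AlgebraicComplexity.LocalStrongUSP

/-!
# Line `cyclic-carry-charts` — crux `ThinBlockAlpha.ThinPackings` (stmt-MatrixMultiplication-10595)

Crux-strategist line (wall-breaker gen 1, planner-cstrat-stmt-MatrixMultiplication-10595-p1-0, 2026-08-17).
Card: `Lines/cyclic-carry-charts.md`.  Namespace `…Cruxes.ThinPackings.CyclicCarryCharts`.

THE MECHANISM.  A *carry chart* over the base interval `[0, q)` assigns to each symbol `x : Γ` three DIGIT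
cells `A x, B x, C x ⊆ [0, q) ⊂ ℕ`.  Rows `row : Fin L → Fin n → Γ` generate blocks in the CYCLIC group
`ℤ/qⁿ` (unbounded exponent!) by the base-`q` digit map `(d_c)_c ↦ Σ_c d_c q^c` (`carryLeg`).  The STPP relation
in `ℤ/qⁿ` unrolls into a CARRY CHAIN (`CarrySolvable`): column sums `e_c = (s'−s)+(t'−t)+(u'−u)` with
`e_c + κ_c = q·κ_{c+1}`, `κ₀ = 0` (carries are automatically `|κ_c| ≤ 2`, since `|e_c| ≤ 3(q−1)`).  A row system is
a *local carry-chart USP* (`IsLocalCarryUSP`) if no ordered triple of rows with indices not all equal is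
carry-solvable; certificates are (i) ROBUST columns (unsolvable mod `q` with tolerance `±2`, e.g. CKSU's single-active
columns with MARGIN digits `[3, q−3]` — `stub_marginUSP`) and (ii) CARRY MOTIFS spanning adjacent columns (a same-sign
column forces `κ = ±1`, an "empty" column kills any nonzero carry) — certificates that do not exist coordinatewise
in `(ℤ/q)ⁿ`.  Compiler `stub_carryCompiler` (cyclic analogue of CKSU Thm 33/37, tree `stub_chartSTPP`): per-symbol
carry-TPP + local carry-chart USP ⇒ `IsSTPP` in `ZMod (q^n)` with product cardinalities.  Heart `stub_carrySeeds`: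
for every `a < 1` ONE fixed carry chart feeds all `η > 0` (finite certificate per `a`; the `η → 0` families are its
word systems).  `ThinPackings_of` composes compiler + heart to the crux BY NAME (`H := ZMod (q^n)`).

WHY IT IS NOT THE DEAD LINES.  Bounded-exponent charts (14848 / Thm B) compile into `(ℤ/q)ⁿ`; here the host is
`ℤ/qⁿ`, exponent `qⁿ → ∞`, outside `TricoloredSumFreeBarrier`; a carry chart all of whose certificates are robust
COLUMNS is shadowed by its mod-`q` chart (hence capped by `a₀(q)`), so every gain must come from MOTIFS — designs
whose mod-`q` shadow violates STPP (the new resource; c1's "order-sensitive invariant separating differences, not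
sums", in digit form).  Frames (NoExcess) were carry-FREE boxes; log-flat/orbit lines are multiplicative; this line is
additive-positional.  By-products already on paper + brute force (calc/margin_usp.py): CKSU local-strong-USP designs
re-host into `ℤ/ℓ^k` with margin digits (⇒ abelian STPP in CYCLIC groups certifies ω ≤ 2.72; ⇒ `Val(ℤ_n) ≥ n^{1+c}`,
c ≈ 0.04–0.09, refuting Pratt 2024 Conj. 4.1 = ledger stmt-7789 `PrimeValConjecture`).

Disproof used: Disproof.lean has no `_false_without_` theorem; §7 costume theorem respected (the heart fixes the
seed per `a`, so an `n = 1` reading of an arbitrary design does not inhabit it); §9 wedge = the line's calibration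
floor (margin avatars of U₂/U₄/U₉); §6 cores: carry legs are not translates (digit cells differ per symbol).
-/

set_option linter.dupNamespace false

namespace Summit.MatrixMultiplication.MatrixMultiplication.Cruxes.ThinPackings.CyclicCarryCharts

open Finset Literature.Computability.AlgebraicComplexity
open Summit.MatrixMultiplication.MatrixMultiplication.Theses.ThinBlockAlpha (ThinPackings)

/-! ## Definitions -/

/-- Base-`q` digit map into the cyclic group `ℤ/qⁿ`: `(d_c)_{c<n} ↦ Σ_c d_c · q^c`. -/
def digitVal (q n : ℕ) (x : Fin n → ℕ) : ZMod (q ^ n) :=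
  ∑ c : Fin n, (x c : ZMod (q ^ n)) * (q : ZMod (q ^ n)) ^ (c : ℕ)

/-- The leg of row `i` generated by the digit cells `cell : Γ → Finset ℕ`: all digit vectors with `d_c ∈ cell (row i c)`,
pushed into `ℤ/qⁿ` by `digitVal`. -/
def carryLeg (q n : ℕ) {Γ : Type} (cell : Γ → Finset ℕ) {L : ℕ} (row : Fin L → Fin n → Γ) (i : Fin L) :
    Finset (ZMod (q ^ n)) :=
  (Fintype.piFinset fun c => cell (row i c)).image (digitVal q n)

/-- All digits of all cells lie below the base `q`. -/
def CellsBelow (q : ℕ) {Γ : Type} (A B C : Γ → Finset ℕ) : Prop :=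
  ∀ x : Γ, (∀ d ∈ A x, d < q) ∧ (∀ d ∈ B x, d < q) ∧ (∀ d ∈ C x, d < q)

/-- The signed column sum of the STPP relation `(s' − s) + (t' − t) + (u' − u)` on digits. -/
def colSum (s s' t t' u u' : ℕ) : ℤ := ((s' : ℤ) - s) + ((t' : ℤ) - t) + ((u' : ℤ) - u)

/-- Per-symbol carry-TPP: a column sum of ONE symbol divisible by `q` forces equal digits (then it is `0`, so a
diagonal relation never emits a carry). -/
def CarrySymbolTPP (q : ℕ) {Γ : Type} (A B C : Γ → Finset ℕ) (x : Γ) : Prop :=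
  ∀ s ∈ A x, ∀ s' ∈ A x, ∀ t ∈ B x, ∀ t' ∈ B x, ∀ u ∈ C x, ∀ u' ∈ C x,
    (q : ℤ) ∣ colSum s s' t t' u u' → s = s' ∧ t = t' ∧ u = u'

/-- Carry-solvability of the ordered symbol-word triple `(x, y, z)` = (words of rows `i, j, k`, index pattern of the
tree's `IsSTPP`: `s ∈ A z, s' ∈ A x, t ∈ B x, t' ∈ B y, u ∈ C y, u' ∈ C z`): digits in the cells and an integer
carry chain `κ` with `κ₀ = 0` and `e_c + κ_c = q κ_{c+1}` for every column (top carry free) — equivalently the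
relation holds in `ℤ/qⁿ`. -/
def CarrySolvable (q n : ℕ) {Γ : Type} (A B C : Γ → Finset ℕ) (x y z : Fin n → Γ) : Prop :=
  ∃ (s s' t t' u u' : Fin n → ℕ) (κ : Fin (n + 1) → ℤ),
    (∀ c, s c ∈ A (z c)) ∧ (∀ c, s' c ∈ A (x c)) ∧ (∀ c, t c ∈ B (x c)) ∧ (∀ c, t' c ∈ B (y c)) ∧
    (∀ c, u c ∈ C (y c)) ∧ (∀ c, u' c ∈ C (z c)) ∧ κ 0 = 0 ∧
    ∀ c : Fin n, colSum (s c) (s' c) (t c) (t' c) (u c) (u' c) + κ c.castSucc = (q : ℤ) * κ c.succ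

/-- **Local carry-chart USP**: no ordered triple of rows with indices not all equal is carry-solvable. -/
def IsLocalCarryUSP (q n : ℕ) {Γ : Type} (A B C : Γ → Finset ℕ) {L : ℕ} (row : Fin L → Fin n → Γ) : Prop :=
  ∀ i j k : Fin L, (i ≠ j ∨ j ≠ k) → ¬ CarrySolvable q n A B C (row i) (row j) (row k)

/-- Margin digits `[3, q−3]`. -/
def marginD (q : ℕ) : Finset ℕ := Finset.Icc 3 (q - 3)

/-- USP cells with margins: symbol `0 ↦ (D, {0}, {0})`, `1 ↦ ({0}, D, {0})`, `2 ↦ ({0}, {0}, D)` — CKSU Thm 33's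
`x_j ≠ 0 iff u_j = 1` with "`≠ 0`" replaced by "`∈ [3, q−3]`". -/
def uspCellA (q : ℕ) : Fin 3 → Finset ℕ := fun x => if x = 0 then marginD q else {0}
/-- see `uspCellA` -/
def uspCellB (q : ℕ) : Fin 3 → Finset ℕ := fun x => if x = 1 then marginD q else {0}
/-- see `uspCellA` -/
def uspCellC (q : ℕ) : Fin 3 → Finset ℕ := fun x => if x = 2 then marginD q else {0}

/-! ## Statements of the stubs as named `Prop`s (`Stmt.stub_*`)

Single source for the compositions, whose hypotheses must be the declared stubs BY NAME for the skeleton audit; the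
REGISTERED stubs `stub_*` below restate them as sorried theorems `theorem stub_X : Stmt.stub_X`. -/
namespace Stmt

/-- Statement of `stub_carryCompiler` (TOOL, L).  **Carry-chart compiler** — the cyclic analogue of CKSU Thm 33/37
(tree `stub_chartSTPP`): cells below `q`, per-symbol carry-TPP and a local carry-chart USP generate an `IsSTPP` family in
the CYCLIC group `ℤ/qⁿ`, with product cardinalities.  Proof plan: an `IsSTPP` relation between `digitVal`s is
`qⁿ ∣ Σ_c e_c q^c`; unroll it into a carry chain (induction on `c`), contradict `IsLocalCarryUSP` off the diagonal; on the
diagonal `CarrySymbolTPP` at column `0` gives equal digits and `κ₁ = 0`, induct; cardinalities by injectivity of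
`digitVal` on digit vectors below `q` (base-`q` uniqueness, `q^n >` value). -/
def stub_carryCompiler : Prop :=
  ∀ (q n : ℕ), 2 ≤ q → ∀ (Γ : Type) (A B C : Γ → Finset ℕ),
    CellsBelow q A B C → (∀ x, CarrySymbolTPP q A B C x) →
    ∀ (L : ℕ) (row : Fin L → Fin n → Γ), IsLocalCarryUSP q n A B C row →
      IsSTPP (carryLeg q n A row) (carryLeg q n B row) (carryLeg q n C row) ∧
      ∀ i : Fin L, (carryLeg q n A row i).card = ∏ c, (A (row i c)).card ∧
        (carryLeg q n B row i).card = ∏ c, (B (row i c)).card ∧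
        (carryLeg q n C row i).card = ∏ c, (C (row i c)).card

/-- Statement of `stub_marginUSP` (CALIBRATION / FIRST RUNG, M).  **Margin-digit USP avatars**: for `q ≥ 8` the USP
cells with margin digits `[3, q−3]` lie below `q`, have carry-TPP, and every local strong USP (tree `IsLocalStrongUSP`,
CKSU §6.1) is a local carry-chart USP over them.  Proof plan (the carry lemma, verified by brute force for U₂, U₄ at
q = 7…13, `calc/margin_usp.py`, and in Lean for U₂ at q = 7, `StrategyCensusSketchP1.avatar_isSTPP`): in any carry
chain at most three digits are active per column, so `|κ_c| ≤ 2`; at the local-strong-USP column of the ordered triple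
`(j, k, i)` (tree's Thm 33 dictionary) exactly one digit `d ∈ [3,q−3]` is active, and `±d + κ ≡ 0 (mod q)` is impossible.
With `stub_carryCompiler` this puts every CKSU Thm-33 design into the cyclic group `ℤ/q^k` (`cyclicAvatar_isSTPP`): abelian
STPP in CYCLIC hosts certifies `ω ≤ 3(log q − log C)/log(q−5)` (≈ 2.72), and `Val(ℤ_n) ≥ n^{1+c}` (Pratt Prop 3.3, tree)
— Pratt 2024 Conj 4.1 (= ledger stmt-7789 `PrimeValConjecture`) fails. -/
def stub_marginUSP : Prop :=
  ∀ (q n L : ℕ), 8 ≤ q → ∀ (row : Fin L → Fin n → Fin 3), IsLocalStrongUSP row →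
    CellsBelow q (uspCellA q) (uspCellB q) (uspCellC q) ∧
    (∀ x, CarrySymbolTPP q (uspCellA q) (uspCellB q) (uspCellC q) x) ∧
    IsLocalCarryUSP q n (uspCellA q) (uspCellB q) (uspCellC q) row

/-- Statement of `stub_carrySeeds` (HEART, open; hardest).  **Carry seeds for every thinness**: for every `a < 1` ONE
carry chart (base `q`, symbol type `Γ`, cells) with cells below `q` and per-symbol carry-TPP, such that for every `η > 0`
some word system over it is a local carry-chart USP whose blocks have the crux shape `⟨N, M, N⟩`, `N ≥ 2`, `N^a ≤ M`, and
near-tight two-leg packing `qⁿ ≤ L·N^{2+η}` in the cyclic host `ℤ/qⁿ`.  A finite certificate per `a`; intended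
technology for the `∀ η` part: the tree's hashing/type-count theorem (`exists_free_diagonal_jointType_card`) over
PAIR-column types (carry motifs become column-local); the seeds must use motifs (robust-column-only seeds are shadowed by
`(ℤ/q)ⁿ` charts and capped by Thm B at `a ≤ a₀(q)`).  First milestones: carry capacity at widths 6–9; a carry chart
beating every `(ℤ/q)`-chart of its base; `a > a₀(q)` for some `q`. -/
def stub_carrySeeds : Prop :=
  ∀ a : ℝ, 0 ≤ a → a < 1 →
    ∃ (q : ℕ) (Γ : Type) (A B C : Γ → Finset ℕ), 2 ≤ q ∧ CellsBelow q A B C ∧ (∀ x, CarrySymbolTPP q A B C x) ∧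
      ∀ η : ℝ, 0 < η → ∃ (n L N M : ℕ) (row : Fin L → Fin n → Γ),
        IsLocalCarryUSP q n A B C row ∧
        (∀ i : Fin L, (∏ c, (A (row i c)).card) = N ∧ (∏ c, (B (row i c)).card) = M ∧
          (∏ c, (C (row i c)).card) = N) ∧
        2 ≤ N ∧ (N : ℝ) ^ a ≤ M ∧ ((q : ℝ) ^ n) ≤ L * (N : ℝ) ^ (2 + η)

end Stmt

/-! ## Registered stubs -/

/-- TOOL (L): the carry-chart compiler, see `Stmt.stub_carryCompiler`. -/
theorem stub_carryCompiler : Stmt.stub_carryCompiler := by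
  sorry

/-- CALIBRATION (M): margin-digit USP avatars are local carry-chart USPs, see `Stmt.stub_marginUSP`. -/
theorem stub_marginUSP : Stmt.stub_marginUSP := by
  sorry

/-- HEART (open): carry seeds for every thinness, see `Stmt.stub_carrySeeds`. -/
theorem stub_carrySeeds : Stmt.stub_carrySeeds := by
  sorry

/-! ## Compositions (kernel-checked, no sorry) -/

/-- The line concludes the crux BY NAME: compiler + seeds ⇒ `ThinBlockAlpha.ThinPackings`, host `H := ZMod (q^n)`. -/
theorem ThinPackings_of : Stmt.stub_carryCompiler → Stmt.stub_carrySeeds → ThinPackings := by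
  intro hC hS a ha0 ha1 η hη
  obtain ⟨q, Γ, A, B, C, hq, hcells, htpp, hall⟩ := hS a ha0 ha1
  obtain ⟨n, L, N, M, row, hU, hcard, hN, hM, hhost⟩ := hall η hη
  obtain ⟨hstpp, hcards⟩ := hC q n hq Γ A B C hcells htpp L row hU
  haveI : NeZero (q ^ n) := ⟨pow_ne_zero _ (by omega)⟩
  refine ⟨ZMod (q ^ n), inferInstance, inferInstance, L, N, M, carryLeg q n A row, carryLeg q n B row,
    carryLeg q n C row, hstpp, ?_, hN, hM, ?_⟩
  · intro i
    obtain ⟨h1, h2, h3⟩ := hcards i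
    obtain ⟨g1, g2, g3⟩ := hcard i
    exact ⟨h1.trans g1, h2.trans g2, h3.trans g3⟩
  · rw [ZMod.card]
    push_cast
    exact hhost

/-- The crux modulo the registered stubs. -/
theorem ThinPackings_proof : ThinPackings := ThinPackings_of stub_carryCompiler stub_carrySeeds

/-- BY-PRODUCT (modulo the two tool stubs): every CKSU Thm-33 design has a CYCLIC avatar — for `q ≥ 8` and every
local strong USP, the margin-digit family is an STPP family in `ℤ/qⁿ` with legs of size `(q−5)^{#symbol}`. -/
theorem cyclicAvatar_isSTPP_of (hM : Stmt.stub_marginUSP) (hC : Stmt.stub_carryCompiler) (q n L : ℕ) (hq : 8 ≤ q)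
    (row : Fin L → Fin n → Fin 3) (hU : IsLocalStrongUSP row) :
    IsSTPP (carryLeg q n (uspCellA q) row) (carryLeg q n (uspCellB q) row) (carryLeg q n (uspCellC q) row) := by
  obtain ⟨hcells, htpp, hcu⟩ := hM q n L hq row hU
  exact (hC q n (by omega) (Fin 3) _ _ _ hcells htpp L row hcu).1

/-- `cyclicAvatar_isSTPP_of` applied to the registered stubs. -/
theorem cyclicAvatar_isSTPP (q n L : ℕ) (hq : 8 ≤ q) (row : Fin L → Fin n → Fin 3) (hU : IsLocalStrongUSP row) :
    IsSTPP (carryLeg q n (uspCellA q) row) (carryLeg q n (uspCellB q) row) (carryLeg q n (uspCellC q) row) :=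
  cyclicAvatar_isSTPP_of stub_marginUSP stub_carryCompiler q n L hq row hU

end Summit.MatrixMultiplication.MatrixMultiplication.Cruxes.ThinPackings.CyclicCarryCharts
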